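import Summits.CriticalPhenomena.SAWScalingLimit.Theorems.SAWDevelopingMapHexTransferQuarterTurnCovariance
import Summits.CriticalPhenomena.SAWScalingLimit.Theorems.SAWLeftRightFKGLeftRightFKGStubMeshReduction
import Literature.Probability.LatticeModels.PlanarIsingMeshTranslate
import HarnessLib

/-!
# Lattice transport for `LatticeSimilarityOfLimit` (item stmt-CriticalPhenomena-7306, route
# SAWConePseudogroup): dilations and lattice translations of the critical `δℤ²` SAW law

Helper file (`--supports stmt-CriticalPhenomena-7306`) for
`SAWConePseudogroupLatticeSimilarityOfLimit.lean`. Exact, mesh-by-mesh covariance of the critical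
self-avoiding-walk law `SAW.law` (`SelfAvoidingWalk.lean`) and of endpoint approximations
(`SAW.IsEndpointApprox`) under the two lattice symmetries that are NOT automorphisms of a fixed
`δℤ²` fixing the origin (those — the quarter turn — are `stub_quarterTurnCovariance` of
`SAWDevelopingMapHexTransferQuarterTurnCovariance.lean`, whose general transport lemma
`map_curve_law_of_iso` along a graph isomorphism of discrete domains is reused here; the
bookkeeping `meshDomain_congr`, `segment_mul` is reused from
`SAWLeftRightFKGLeftRightFKGStubMeshReduction.lean`, where the special case `Ω = dom C` of the
dilation identity appears):

* **Dilation `z ↦ r z`, `r > 0`** (`(λΩ)_δ = λ·Ω_{δ/λ}`, Lawler–Schramm–Werner 2004 §3.4.2): the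
  discretisations `(rΩ)_δ` and `Ω_{δ/r}` are the SAME graph on the sites of `ℤ²`
  (`meshVertices_dilate`, `meshGraph_dilate`, `meshDomain_dilate`, `discreteDomainGraph_dilate`:
  mesh vertices, the closed-segment edge rule and Smirnov's union-of-largest-components convention
  only see the points `δ x = r · (δ/r) x`), so the identity of `ℤ²` is a graph isomorphism realised
  on mesh points by `z ↦ r z` and the law is transported (`map_curve_law_dilate`); an endpoint
  approximation of `D` read at the meshes `δ / r` is one of `r D` (`isEndpointApprox_dilate`).
* **Translation by a lattice vector `w = δ v`**: `x ↦ x + v` is a graph isomorphism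
  `Ω_δ ≃g (w + Ω)_δ` (`discreteDomainGraph_adj_add_iff`, from `discreteDomainGraph_adj_vadd` of
  `PlanarIsingMeshTranslate.lean`), whence `map_curve_law_translate`; and endpoint approximations
  of `w + D` can be SPLICED from translates `a δ + v δ` at the meshes where `w ∈ δℤ²` and any
  endpoint approximation of `w + D` elsewhere (`isEndpointApprox_splice`).

References: G. F. Lawler, O. Schramm, W. Werner, *On the scaling limit of planar self-avoiding
walk* (2004), §3.4.2; S. Smirnov, C. R. Acad. Sci. Paris 333 (2001), §2 (largest-component
discretisation); V. Beffara, *Is critical 2D percolation universal?* (2008), §2.2. All [folklore].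
-/

noncomputable section

open MeasureTheory Filter Topology Set
open scoped Pointwise
open Literature.Probability.LatticeModels Literature.Probability.RandomPlanarGeometry
open Summit.CriticalPhenomena.SAWScalingLimit.Cruxes.HexTransfer.PinTheShear (map_curve_law_of_iso)
open Summit.CriticalPhenomena.SAWScalingLimit.Theorems.LeftRightFKG.CornerLoc
  (meshDomain_congr segment_mul)

namespace Summit.CriticalPhenomena.SAWScalingLimit.Theorems.LatticeSimilarityOfLimit

/-! ### Dilations transport the discretisation: `(rΩ)_δ = Ω_{δ/r}` on the same sites -/

section Dilation

variable {Ω : Set ℂ} {r : ℝ}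

/-- `δ x = r · ((δ/r) x)` on mesh points (`r ≠ 0`). [folklore] -/
theorem meshPoint_eq_mul_meshPoint_div (hr : r ≠ 0) (δ : ℝ) (x : Site 2) :
    meshPoint δ x = (r : ℂ) * meshPoint (δ / r) x := by
  have hr' : (r : ℂ) ≠ 0 := Complex.ofReal_ne_zero.2 hr
  simp only [meshPoint, ← mul_assoc]
  congr 1
  push_cast
  field_simp

/-- The dilation `similarity r _ 0` is `z ↦ r z` on points. [folklore] -/
theorem similarity_ofReal_apply (hr : (r : ℂ) ≠ 0) (z : ℂ) : similarity r hr 0 z = (r : ℂ) * z := by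
  rw [similarity_apply, add_zero]

/-- Similarities are affine on segments. [folklore] -/
theorem similarity_lineMap (c : ℂ) (hc : c ≠ 0) (w x y : ℂ) (t : ℝ) :
    similarity c hc w (AffineMap.lineMap x y t) =
      AffineMap.lineMap (similarity c hc w x) (similarity c hc w y) t := by
  simp only [similarity_apply, AffineMap.lineMap_apply_module, Complex.real_smul]
  push_cast
  ring

/-- **Mesh vertices under dilation**: the sites of `(rΩ) ∩ δℤ²` are the sites of `Ω ∩ (δ/r)ℤ²`.
[folklore] -/
theorem meshVertices_dilate (hr : 0 < r) (hr' : (r : ℂ) ≠ 0) (δ : ℝ) :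
    meshVertices ((similarity r hr' 0) '' Ω) δ = meshVertices Ω (δ / r) := by
  ext x
  rw [mem_meshVertices_iff, mem_meshVertices_iff, meshPoint_eq_mul_meshPoint_div hr.ne' δ x]
  constructor
  · rintro ⟨z, hz, h⟩
    rw [similarity_ofReal_apply] at h
    rwa [← mul_left_cancel₀ hr' h]
  · intro h
    exact ⟨_, h, similarity_ofReal_apply hr' _⟩

/-- The closed-segment edge rule under dilation. [folklore] -/
theorem segment_mul_subset_closure_iff (hr' : (r : ℂ) ≠ 0) (p q : ℂ) :
    segment ℝ ((r : ℂ) * p) ((r : ℂ) * q) ⊆ closure ((similarity r hr' 0) '' Ω) ↔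
      segment ℝ p q ⊆ closure Ω := by
  have hseg : segment ℝ ((r : ℂ) * p) ((r : ℂ) * q) = (similarity r hr' 0) '' segment ℝ p q :=
    (segment_mul (r : ℂ) p q).trans (image_congr fun z _ => (similarity_ofReal_apply hr' z).symm)
  rw [hseg, ← Homeomorph.image_closure, image_subset_image_iff (similarity r hr' 0).injective]

/-- **The mesh graph under dilation**: `meshGraph (rΩ) δ = meshGraph Ω (δ/r)`. [folklore] -/
theorem meshGraph_dilate (hr : 0 < r) (hr' : (r : ℂ) ≠ 0) (δ : ℝ) :
    meshGraph ((similarity r hr' 0) '' Ω) δ = meshGraph Ω (δ / r) := by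
  ext x y
  rw [meshGraph_adj_iff, meshGraph_adj_iff, meshPoint_eq_mul_meshPoint_div hr.ne' δ x,
    meshPoint_eq_mul_meshPoint_div hr.ne' δ y, segment_mul_subset_closure_iff hr']

/-- **The discrete domain under dilation**: `(rΩ)_δ = Ω_{δ/r}` as a set of sites (Smirnov's
largest-component convention is dilation-equivariant; `meshDomain` is a function of the mesh
vertex set and the mesh graph only, `meshDomain_congr`). [folklore] -/
theorem meshDomain_dilate (hr : 0 < r) (hr' : (r : ℂ) ≠ 0) (δ : ℝ) :
    meshDomain ((similarity r hr' 0) '' Ω) δ = meshDomain Ω (δ / r) :=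
  meshDomain_congr (meshVertices_dilate hr hr' δ) (meshGraph_dilate hr hr' δ)

/-- **The graph `Ω_δ` under dilation**: `discreteDomainGraph (rΩ) δ = discreteDomainGraph Ω (δ/r)`,
i.e. `(λΩ)_δ = λ · Ω_{δ/λ}` read on the sites of `ℤ²`. [folklore] -/
theorem discreteDomainGraph_dilate (hr : 0 < r) (hr' : (r : ℂ) ≠ 0) (δ : ℝ) :
    discreteDomainGraph ((similarity r hr' 0) '' Ω) δ = discreteDomainGraph Ω (δ / r) := by
  unfold discreteDomainGraph
  rw [meshGraph_dilate hr hr' δ, meshDomain_dilate hr hr' δ]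

/-- **Exact dilation covariance of the critical SAW law at every mesh**: the critical SAW law of
`Ω_{δ/r}` from `a` to `b`, pushed to curves and dilated by `z ↦ r z`, is the critical SAW law of
`(rΩ)_δ` from `a` to `b` pushed to curves (transport along the identity of `ℤ²`, a graph
isomorphism `Ω_{δ/r} ≃g (rΩ)_δ` realised on mesh points by `z ↦ r z`). [folklore] -/
theorem map_curve_law_dilate (hr : 0 < r) (hr' : (r : ℂ) ≠ 0) (Ω : Set ℂ) (δ : ℝ) (a b : Site 2) :
    ((SAW.law Ω (δ / r) a b).map (fun γ => γ.curve)).map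
        (CurveClass.map (similarity r hr' 0 : C(ℂ, ℂ))) =
      (SAW.law ((similarity r hr' 0) '' Ω) δ a b).map (fun γ => γ.curve) := by
  refine map_curve_law_of_iso
    (⟨Equiv.refl _, by
      intro x y
      rw [discreteDomainGraph_dilate hr hr' δ]
      rfl⟩ : discreteDomainGraph Ω (δ / r) ≃g discreteDomainGraph ((similarity r hr' 0) '' Ω) δ)
    _ (measurable_curveClassMap_similarity _ _ _) (similarity_lineMap _ _ _) (fun x => ?_) rfl rfl
  change similarity r hr' 0 (meshPoint (δ / r) x) = meshPoint δ x
  rw [similarity_ofReal_apply, ← meshPoint_eq_mul_meshPoint_div hr.ne']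

/-- An endpoint approximation of `D` read at the meshes `δ / r` is an endpoint approximation of the
dilated domain `r D`. [folklore] -/
theorem isEndpointApprox_dilate (hr : 0 < r) (hr' : (r : ℂ) ≠ 0) {D : DobrushinDomain}
    {a b : ℝ → Site 2} (hab : SAW.IsEndpointApprox D a b) :
    SAW.IsEndpointApprox (D.map (similarity r hr' 0)) (fun δ => a (δ / r)) (fun δ => b (δ / r)) := by
  have hdiv : Tendsto (fun δ : ℝ => δ / r) (𝓝[>] (0 : ℝ)) (𝓝[>] (0 : ℝ)) := by
    refine tendsto_nhdsWithin_iff.2 ⟨?_, ?_⟩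
    · have h : Tendsto (fun δ : ℝ => δ / r) (𝓝 (0 : ℝ)) (𝓝 (0 / r)) :=
        tendsto_id.div_const r
      rw [zero_div] at h
      exact h.mono_left nhdsWithin_le_nhds
    · filter_upwards [self_mem_nhdsWithin] with δ hδ
      exact div_pos hδ hr
  refine ⟨?_, ?_, ?_⟩
  · have h := hab.reachable
    have h' := hdiv.eventually h
    filter_upwards [h'] with δ hδ
    change (discreteDomainGraph ((similarity r hr' 0) '' D.carrier) δ).Reachable (a (δ / r))
      (b (δ / r))
    rw [discreteDomainGraph_dilate hr hr' δ]
    exact hδ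
  · have h := ((similarity r hr' 0).continuous.tendsto _).comp (hab.tendsto_fst.comp hdiv)
    refine (h.congr fun δ => ?_).trans (by rfl)
    change similarity r hr' 0 (meshPoint (δ / r) (a (δ / r))) = meshPoint δ (a (δ / r))
    rw [similarity_ofReal_apply, ← meshPoint_eq_mul_meshPoint_div hr.ne']
  · have h := ((similarity r hr' 0).continuous.tendsto _).comp (hab.tendsto_snd.comp hdiv)
    refine (h.congr fun δ => ?_).trans (by rfl)
    change similarity r hr' 0 (meshPoint (δ / r) (b (δ / r))) = meshPoint δ (b (δ / r))
    rw [similarity_ofReal_apply, ← meshPoint_eq_mul_meshPoint_div hr.ne']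

end Dilation

/-! ### Lattice translations -/

section Translation

variable {Ω : Set ℂ} {δ : ℝ}

/-- `z ↦ 1 · z + w` has image `w + Ω`. [folklore] -/
theorem image_similarity_one (w : ℂ) (Ω : Set ℂ) :
    (similarity 1 one_ne_zero w) '' Ω = w +ᵥ Ω := by
  ext z
  simp only [mem_image, similarity_apply, one_mul, Set.mem_vadd_set, vadd_eq_add]
  constructor
  · rintro ⟨y, hy, rfl⟩
    exact ⟨y, hy, add_comm _ _⟩
  · rintro ⟨y, hy, rfl⟩
    exact ⟨y, hy, add_comm _ _⟩

/-- Translation by a lattice vector `v` with `δ v = w` carries the graph `Ω_δ` onto `(w + Ω)_δ`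
(`discreteDomainGraph_adj_vadd`), so `x ↦ x + v` is a graph isomorphism `Ω_δ ≃g (w + Ω)_δ`.
[folklore] -/
theorem discreteDomainGraph_adj_add_iff (Ω : Set ℂ) (δ : ℝ) (v : Site 2) {w : ℂ}
    (hw : meshPoint δ v = w) (x y : Site 2) :
    (discreteDomainGraph ((similarity 1 one_ne_zero w) '' Ω) δ).Adj (x + v) (y + v) ↔
      (discreteDomainGraph Ω δ).Adj x y := by
  rw [image_similarity_one, ← hw, discreteDomainGraph_adj_vadd, add_sub_cancel_right,
    add_sub_cancel_right]

/-- **Exact translation covariance of the critical SAW law at the meshes `δ` with `w ∈ δℤ²`**: if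
`w = δ v`, the critical SAW law of `Ω_δ` from `a` to `b`, pushed to curves and translated by `w`, is
the critical SAW law of `(w + Ω)_δ` from `a + v` to `b + v` pushed to curves. [folklore] -/
theorem map_curve_law_translate (Ω : Set ℂ) (δ : ℝ) (v : Site 2) {w : ℂ} (hw : meshPoint δ v = w)
    (a b : Site 2) :
    ((SAW.law Ω δ a b).map (fun γ => γ.curve)).map
        (CurveClass.map (similarity 1 one_ne_zero w : C(ℂ, ℂ))) =
      (SAW.law ((similarity 1 one_ne_zero w) '' Ω) δ (a + v) (b + v)).map (fun γ => γ.curve) := by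
  refine map_curve_law_of_iso
    (⟨Equiv.addRight v, by
      intro x y
      exact discreteDomainGraph_adj_add_iff Ω δ v hw x y⟩ :
      discreteDomainGraph Ω δ ≃g discreteDomainGraph ((similarity 1 one_ne_zero w) '' Ω) δ)
    _ (measurable_curveClassMap_similarity _ _ _) (similarity_lineMap _ _ _) (fun x => ?_) rfl rfl
  change similarity 1 one_ne_zero w (meshPoint δ x) = meshPoint δ (x + v)
  rw [similarity_apply, one_mul, ← hw]
  exact Complex.ext (by simp [mul_add]) (by simp [mul_add])

/-- The curve law `(SAW.law Ω δ a b).map curve` as a function of the pair of endpoints (to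
substitute equal endpoints under the dependent type `DomainSAW Ω δ a b`). [folklore] -/
theorem map_curve_law_congr {Ω : Set ℂ} {δ : ℝ} {a₁ a₂ b₁ b₂ : Site 2} (ha : a₁ = a₂)
    (hb : b₁ = b₂) :
    (SAW.law Ω δ a₁ b₁).map (fun γ => γ.curve) = (SAW.law Ω δ a₂ b₂).map (fun γ => γ.curve) := by
  subst ha hb
  rfl

/-- **Spliced endpoint approximations of a translated domain.** Given an endpoint approximation
`(a, b)` of `D`, an endpoint approximation `(a₀, b₀)` of `w + D`, lattice vectors `v δ` and a
decidable selection `p` of meshes at which `w = δ · v δ`, the splice "`a δ + v δ` if `p δ`, else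
`a₀ δ`" is an endpoint approximation of `w + D`. [folklore] -/
theorem isEndpointApprox_splice {D : DobrushinDomain} (w : ℂ) {a b a₀ b₀ : ℝ → Site 2}
    (hab : SAW.IsEndpointApprox D a b)
    (h₀ : SAW.IsEndpointApprox (D.map (similarity 1 one_ne_zero w)) a₀ b₀)
    (v : ℝ → Site 2) (p : ℝ → Prop) [DecidablePred p] (hp : ∀ δ, p δ → meshPoint δ (v δ) = w) :
    SAW.IsEndpointApprox (D.map (similarity 1 one_ne_zero w))
      (fun δ => if p δ then a δ + v δ else a₀ δ) (fun δ => if p δ then b δ + v δ else b₀ δ) := by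
  have hpt : ∀ i, (D.map (similarity 1 one_ne_zero w)).pt i = D.pt i + w := fun i => by
    rw [MarkedDomain.pt_map, similarity_apply, one_mul]
  have key : ∀ {c c₀ : ℝ → Site 2} {z : ℂ}, Tendsto (fun δ => meshPoint δ (c δ)) (𝓝[>] 0) (𝓝 z) →
      Tendsto (fun δ => meshPoint δ (c₀ δ)) (𝓝[>] 0) (𝓝 (z + w)) →
      Tendsto (fun δ => meshPoint δ (if p δ then c δ + v δ else c₀ δ)) (𝓝[>] 0) (𝓝 (z + w)) := by
    intro c c₀ z hc hc₀
    have heq : (fun δ => meshPoint δ (if p δ then c δ + v δ else c₀ δ)) =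
        fun δ => if p δ then meshPoint δ (c δ) + w else meshPoint δ (c₀ δ) := by
      funext δ
      split_ifs with h
      · rw [← hp δ h]
        exact Complex.ext (by simp [mul_add]) (by simp [mul_add])
      · rfl
    rw [heq]
    exact (tendsto_inf_left (hc.add_const w)).if (tendsto_inf_left hc₀)
  refine ⟨?_, ?_, ?_⟩
  · filter_upwards [hab.reachable, h₀.reachable] with δ h1 h2
    by_cases hδ : p δ
    · simp only [if_pos hδ]
      exact h1.map ⟨fun x => x + v δ, fun h =>
        (discreteDomainGraph_adj_add_iff D.carrier δ (v δ) (hp δ hδ) _ _).2 h⟩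
    · simp only [if_neg hδ]
      exact h2
  · rw [hpt]
    exact key hab.tendsto_fst ((hpt 0) ▸ h₀.tendsto_fst)
  · rw [hpt]
    exact key hab.tendsto_snd ((hpt 1) ▸ h₀.tendsto_snd)

end Translation

end Summit.CriticalPhenomena.SAWScalingLimit.Theorems.LatticeSimilarityOfLimit

end
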